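import Summits.ResolutionOfSingularities.ResolutionOfSingularities.Theorems.FrobeniusLadderFInjectiveMacaulayficationE8Forms
import HarnessLib

/-!
# The `E₇⁰`-type forms of the second step of the characteristic-`3` tower over `E₈⁰`

Support file for crux stmt-ResolutionOfSingularities-15315
(`FrobeniusLadder.FInjectiveMacaulayfication`, line `Sketch`, seat c5, wave 3): stub `stub_e7Forms`
of the CALIBRATION package (second step of the characteristic-`3` tower for `E₈⁰`). The first point
blow-up of `z² + x³ + y⁵` carries one bad point, the origin of the `y`-chart hypersurface
`k[X₀,X₁,X₂]/(g)` with `g = X₂² + X₁X₀³ + X₁³` (the `g_y` of `E8Forms.stub_e8Forms`); this file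
records the forms met when THAT point is blown up. With the chart substitutions
`θᵢ : Xᵢ ↦ Xᵢ, Xⱼ ↦ XⱼXᵢ (j ≠ i)`:

* `X₀`-chart: `θ₀ g = X₀² h₀`, `h₀ = X₂² + X₁X₀² + X₀X₁³`;
* `X₁`-chart: `θ₁ g = X₁² h₁`, `h₁ = X₂² + X₁ + X₀³X₁²`.

What is proved (over EVERY field `k`, no characteristic hypothesis):

* `mul_self_ne_neg_of_aeval_eq_neg` — the odd-degree non-square test of
  `E8Forms.mul_self_ne_neg_of_aeval` with an arbitrary odd-degree target `w ∈ k[T]` in place of a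
  monomial `T^(2n+1)`: if some evaluation `k[X₀,X₁] → k[T]` sends `c` to `-w`, `deg w` odd, then
  `-c` is not a square.
* `stub_e7Forms` — the registered statement: `(g)`, `(h₀)`, `(h₁)` are prime ideals of
  `k[X₀,X₁,X₂]`, `g ≠ 0`, `X₀ ∉ (h₀)`, `X₁ ∉ (h₁)`, and the two identities `θ₀ g = X₀² h₀`,
  `θ₁ g = X₁² h₁`. As in the template file, all three forms are `X₂² + c(X₀,X₁)`; under the
  identification `k[X₀,X₁,X₂] ≃ k[X₀,X₁][T]`, `X₂ ↦ T` (`renameEquiv (swap 0 2)` then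
  `finSuccEquiv`) they become `T² + c` and `E8Forms.prime_and_not_dvd_of_ringEquiv` applies once
  `-c` is known to be a non-square: for `g` and `h₁` set one variable to `0` (`-T³`, `-T`); for
  `h₀`, where `c = X₀X₁(X₀ + X₁²)` (over `𝔽₂` no monomial evaluation of it is `T^(odd)`, so the
  monomial test of the template does not apply uniformly), evaluate `(X₀, X₁) ↦ (-T, 1)` to get
  `-(T³ + T)`, of odd degree `3`.

References: M. Artin, *Coverings of the rational double points in characteristic `p`* [Artin1977]
(the forms `E₈⁰`, `E₇⁰`); the algebra is folklore.
-/

-- single-problem summit: the doubled namespace component is forced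
set_option linter.dupNamespace false

namespace Summit.ResolutionOfSingularities.ResolutionOfSingularities.Theorems.FInjectiveMacaulayfication.E7Forms

open Polynomial
open Summit.ResolutionOfSingularities.ResolutionOfSingularities.Theorems.FInjectiveMacaulayfication

/-- **Odd-degree test for non-squares (general target).** If an evaluation `k[X₀,X₁] → k[T]` sends
`c` to `-w` with `deg w` odd, then `-c` is not a square in `k[X₀,X₁]`: a square root `a` would
evaluate to a polynomial `b` with `b² = w`, and `deg (b²) = 2 deg b` is even (`b = 0` would force
`w = 0`, of even degree `0`). [folklore] -/
theorem mul_self_ne_neg_of_aeval_eq_neg {k : Type} [Field k] {c : MvPolynomial (Fin 2) k}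
    (v : Fin 2 → k[X]) (w : k[X]) (hw : Odd w.natDegree)
    (hv : MvPolynomial.aeval v c = -w) (a : MvPolynomial (Fin 2) k) : a * a ≠ -c := by
  intro h
  have h2 : MvPolynomial.aeval v a * MvPolynomial.aeval v a = w := by
    rw [← map_mul, h, map_neg, hv, neg_neg]
  obtain ⟨m, hm⟩ := hw
  by_cases ha : MvPolynomial.aeval v a = 0
  · rw [ha, zero_mul] at h2
    rw [← h2, natDegree_zero] at hm
    omega
  · have h3 := congrArg Polynomial.natDegree h2
    rw [natDegree_mul ha ha] at h3
    omega

/-- **The `E₇⁰`-type forms of the second step** (registered stub `stub_e7Forms` of the §7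
calibration): for `g = X₂² + X₁X₀³ + X₁³`, `h₀ = X₂² + X₁X₀² + X₀X₁³`, `h₁ = X₂² + X₁ + X₀³X₁²` in
`k[X₀,X₁,X₂]` over any field `k`: `(g)`, `(h₀)`, `(h₁)` are prime, `g ≠ 0`, `X₀ ∉ (h₀)`,
`X₁ ∉ (h₁)`, and the strict-transform identities `θ₀ g = X₀² h₀`, `θ₁ g = X₁² h₁` for the chart
substitutions `θᵢ : Xᵢ ↦ Xᵢ, Xⱼ ↦ XⱼXᵢ`. Proof: identify `k[X₀,X₁,X₂]` with `k[X₀,X₁][T]`,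
`X₂ ↦ T` (`renameEquiv (swap 0 2)` then `finSuccEquiv`); each form becomes `T² + c` with `-c` a
non-square by the odd-degree test (evaluations `(X₀,X₁) ↦ (0,-T)`, `(-T, 1)`, `(0,-T)` give `-T³`,
`-(T³ + T)`, `-T`), so `E8Forms.prime_and_not_dvd_of_ringEquiv` applies; the identities are `ring`.
[folklore] -/
theorem stub_e7Forms : ∀ (k : Type) [Field k] (g h0 h1 : MvPolynomial (Fin 3) k),
    g = MvPolynomial.X 2 ^ 2 + MvPolynomial.X 1 * MvPolynomial.X 0 ^ 3 + MvPolynomial.X 1 ^ 3 →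
    h0 = MvPolynomial.X 2 ^ 2 + MvPolynomial.X 1 * MvPolynomial.X 0 ^ 2 + MvPolynomial.X 0 * MvPolynomial.X 1 ^ 3 →
    h1 = MvPolynomial.X 2 ^ 2 + MvPolynomial.X 1 + MvPolynomial.X 0 ^ 3 * MvPolynomial.X 1 ^ 2 →
    ((Ideal.span {g}).IsPrime ∧ g ≠ 0) ∧
    ((Ideal.span {h0}).IsPrime ∧ MvPolynomial.X 0 ∉ Ideal.span {h0} ∧
      MvPolynomial.aeval (fun j : Fin 3 => if j = 0 then (MvPolynomial.X 0 : MvPolynomial (Fin 3) k)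
        else MvPolynomial.X j * MvPolynomial.X 0) g = MvPolynomial.X 0 ^ 2 * h0) ∧
    ((Ideal.span {h1}).IsPrime ∧ MvPolynomial.X 1 ∉ Ideal.span {h1} ∧
      MvPolynomial.aeval (fun j : Fin 3 => if j = 1 then (MvPolynomial.X 1 : MvPolynomial (Fin 3) k)
        else MvPolynomial.X j * MvPolynomial.X 1) g = MvPolynomial.X 1 ^ 2 * h1) := by
  intro k _ g h0 h1 hg hh0 hh1
  -- the identification `k[X₀,X₁,X₂] ≃ k[X₀,X₁][T]`: `X 2 ↦ T`, `X 0 ↦ C (X 1)`, `X 1 ↦ C (X 0)`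
  obtain ⟨e, he0, he1, he2⟩ : ∃ e : MvPolynomial (Fin 3) k ≃+* (MvPolynomial (Fin 2) k)[X],
      e (MvPolynomial.X 0) = C (MvPolynomial.X 1) ∧ e (MvPolynomial.X 1) = C (MvPolynomial.X 0) ∧
        e (MvPolynomial.X 2) = Polynomial.X := by
    refine ⟨((MvPolynomial.renameEquiv k (Equiv.swap (0 : Fin 3) 2)).trans
      (MvPolynomial.finSuccEquiv k 2)).toRingEquiv, ?_, ?_, ?_⟩
    · show MvPolynomial.finSuccEquiv k 2
          (MvPolynomial.rename (Equiv.swap (0 : Fin 3) 2) (MvPolynomial.X 0)) = _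
      rw [MvPolynomial.rename_X, Equiv.swap_apply_left]
      exact MvPolynomial.finSuccEquiv_X_succ (j := 1)
    · show MvPolynomial.finSuccEquiv k 2
          (MvPolynomial.rename (Equiv.swap (0 : Fin 3) 2) (MvPolynomial.X 1)) = _
      rw [MvPolynomial.rename_X, Equiv.swap_apply_of_ne_of_ne (by decide) (by decide)]
      exact MvPolynomial.finSuccEquiv_X_succ (j := 0)
    · show MvPolynomial.finSuccEquiv k 2
          (MvPolynomial.rename (Equiv.swap (0 : Fin 3) 2) (MvPolynomial.X 2)) = _
      rw [MvPolynomial.rename_X, Equiv.swap_apply_right]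
      exact MvPolynomial.finSuccEquiv_X_zero
  -- images of the three forms
  have heg :
      e g = X ^ 2 + C (MvPolynomial.X 0 * MvPolynomial.X 1 ^ 3 + MvPolynomial.X 0 ^ 3) := by
    subst hg
    simp only [map_add, map_mul, map_pow, he0, he1, he2]
    ring
  have heh0 : e h0 = X ^ 2 +
      C (MvPolynomial.X 0 * MvPolynomial.X 1 ^ 2 + MvPolynomial.X 1 * MvPolynomial.X 0 ^ 3) := by
    subst hh0
    simp only [map_add, map_mul, map_pow, he0, he1, he2]
    ring
  have heh1 :
      e h1 = X ^ 2 + C (MvPolynomial.X 0 + MvPolynomial.X 1 ^ 3 * MvPolynomial.X 0 ^ 2) := by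
    subst hh1
    simp only [map_add, map_mul, map_pow, he0, he1, he2]
    ring
  -- the non-square tests
  have hcg : ∀ a : MvPolynomial (Fin 2) k,
      a * a ≠ -(MvPolynomial.X 0 * MvPolynomial.X 1 ^ 3 + MvPolynomial.X 0 ^ 3) :=
    E8Forms.mul_self_ne_neg_of_aeval ![-Polynomial.X, 0] 1 (by
      simp only [map_add, map_mul, map_pow, MvPolynomial.aeval_X, Matrix.cons_val_zero,
        Matrix.cons_val_one]
      ring)
  have hw : Odd (X ^ 3 + X : k[X]).natDegree := by
    rw [natDegree_add_eq_left_of_natDegree_lt (by rw [natDegree_X_pow, natDegree_X]; decide),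
      natDegree_X_pow]
    exact ⟨1, rfl⟩
  have hch0 : ∀ a : MvPolynomial (Fin 2) k, a * a ≠
      -(MvPolynomial.X 0 * MvPolynomial.X 1 ^ 2 + MvPolynomial.X 1 * MvPolynomial.X 0 ^ 3) :=
    mul_self_ne_neg_of_aeval_eq_neg ![-Polynomial.X, 1] (X ^ 3 + X) hw (by
      simp only [map_add, map_mul, map_pow, MvPolynomial.aeval_X, Matrix.cons_val_zero,
        Matrix.cons_val_one]
      ring)
  have hch1 : ∀ a : MvPolynomial (Fin 2) k,
      a * a ≠ -(MvPolynomial.X 0 + MvPolynomial.X 1 ^ 3 * MvPolynomial.X 0 ^ 2) :=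
    E8Forms.mul_self_ne_neg_of_aeval ![-Polynomial.X, 0] 0 (by
      simp only [map_add, map_mul, map_pow, MvPolynomial.aeval_X, Matrix.cons_val_zero,
        Matrix.cons_val_one]
      ring)
  obtain ⟨hpg, -⟩ := E8Forms.prime_and_not_dvd_of_ringEquiv e g _ heg hcg
  obtain ⟨hph0, hdh0⟩ := E8Forms.prime_and_not_dvd_of_ringEquiv e h0 _ heh0 hch0
  obtain ⟨hph1, hdh1⟩ := E8Forms.prime_and_not_dvd_of_ringEquiv e h1 _ heh1 hch1
  have hX0 : (MvPolynomial.X 0 : MvPolynomial (Fin 2) k) ≠ 0 := MvPolynomial.X_ne_zero 0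
  have hX1 : (MvPolynomial.X 1 : MvPolynomial (Fin 2) k) ≠ 0 := MvPolynomial.X_ne_zero 1
  refine ⟨⟨(Ideal.span_singleton_prime hpg.ne_zero).mpr hpg, hpg.ne_zero⟩,
    ⟨(Ideal.span_singleton_prime hph0.ne_zero).mpr hph0,
      fun h => hdh0 _ _ hX1 he0 (Ideal.mem_span_singleton.mp h), ?_⟩,
    ⟨(Ideal.span_singleton_prime hph1.ne_zero).mpr hph1,
      fun h => hdh1 _ _ hX0 he1 (Ideal.mem_span_singleton.mp h), ?_⟩⟩
  · subst hg hh0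
    simp only [map_add, map_mul, map_pow, MvPolynomial.aeval_X, Fin.isValue, Fin.reduceEq,
      ↓reduceIte, one_ne_zero]
    ring
  · subst hg hh1
    simp only [map_add, map_mul, map_pow, MvPolynomial.aeval_X, Fin.isValue, Fin.reduceEq,
      ↓reduceIte, zero_ne_one]
    ring

end Summit.ResolutionOfSingularities.ResolutionOfSingularities.Theorems.FInjectiveMacaulayfication.E7Forms
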